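/-
Copyright (c) 2026 the pub-hodgecm-mathlib formalisation cell (harness21).  Prover seat hodgecm-mathlib-LH4-p09 (g5): Track A «(D-RAM) FOUR-FRAME» squad of crux H413, unit U2H (ii-H),
leaf (ρ2b′-X) — payer LH4-p14 (g4) socket (C) brick (C2) «H-SIDE CLOSED FORM», the class link AT A PLACE: residue approximation along `ι_w` at a ramified non-split place, and the
selector «`e(w|v) = 1` kills the Eisenstein datum, `e(w|v) = 2` kills the inert datum», 2026-09-04.
-/
import Literature.NumberTheory.Automorphic.RamifiedPlaceResidueFieldBridge      -- ★ (F0P3a-p03): `toPlace_mem_integer`, `isUnit_toPlace_integer_iff` (ι_w is a local hom on integers); brings ★ `natCard_residueField_eq_of_ramified`, ★ `ramificationIdx'_eq_two_of_ne_one`, ★ `valued_toPlace`, the Valued∕ValuativeRel bridge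
import Literature.NumberTheory.Automorphic.QuadraticDatumRamificationLink         -- ★ p857779 (this seat): `false_of_eisensteinDatum_of_isometry`, `false_of_inertDatum_of_sq_of_residue`
import Literature.NumberTheory.Automorphic.IwahoriGL                              -- ★ `residue_eq_zero_iff_valuation_lt_one`
import Literature.NumberTheory.Automorphic.ProjectiveDescentLatticeLevelsDischarge  -- ★ (B-p14): `valued_toPlace_eq_pow_two_of_ramified` (`e(w|v) ≠ 1 ⇒ |ι_w y|_w = |y|_v²`)
import HarnessLib

/-!
# Residue approximation along `ι_w : F_v → E_w` at a RAMIFIED non-split place of a quadratic extension (`f(w|v) = 1`: every integer of `E_w` is `ι_w(y) + 𝔪_w`), and the CLASS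
# SELECTOR for a quadratic datum of `D ∈ F_v` with `√D ∈ E_w`: `e(w|v) = 1` ⇒ no Eisenstein datum, `e(w|v) = 2` ⇒ no inert datum (Neukirch, ANT I §8, II §4; Serre, *Local Fields* I §6, III §5)

Topic `NumberTheory/Automorphic`; namespace `Literature.NumberTheory.Automorphic.UnitaryGroup` (as ★ `RamifiedPlaceResidueFieldBridge`).  THEOREMS ONLY (no definition, no instance, no
notation, no named fact, no `sorry`); kernel lane `--supports stmt-HodgeConjecture-24833` (count-neutral).  Cell `pub/hodgecm-mathlib` (D-0151), crux H413; Track A «(D-RAM) FOUR-FRAME»,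
unit U2H (ii-H), leaf (ρ2b′-X) `stub_U2H_fixedPointCensus_typeTwo_unit0` (U2H ED. 15 :418): payer LH4-p14 (g4)'s socket (C), brick (C2) «H-SIDE CLOSED FORM» (this seat, ★ p857582 ∕
p857631 ∕ p857663 ∕ p857701 ∕ p857779).  ★ p857701 `hSide_closedForm_of_tube` hands the census file an INERT-or-EISENSTEIN datum of `Δ_g` with the matching ℕ-law; the census file
splits on the ramification of the third field `Kf″ = Fix(cθ)` of the S2′ biquadratic model (route (a), LH4-p05 (g4) ∕ LH4-p07 (g7)) at its place `v″` under `w′` — a GLOBAL quadratic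
extension of `F = L⁺` with `√Δ_g ∈ Kf″_{v″}`.  ★ p857779 refutes the wrong branch from `|ι y| = |y|` (resp. `|ι y| = |y|²` + residue approximation); THIS file supplies those two
inputs AT A PLACE of any quadratic extension `F ⊆ E` (`c` its non-trivial automorphism, `c • w = w`), so the selector is ONE call per branch.

* §1 `valued_toPlace_eq_self_of_ramificationIdx_eq_one` (`e(w|v) = 1 ⇒ |ι_w y|_w = |y|_v`, ★ `valued_toPlace`); the ramified twin `|ι_w y|_w = |y|_v²` is ★
  `valued_toPlace_eq_pow_two_of_ramified` (B-p14, imported).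
* §2 **`exists_valued_sub_toPlace_lt_one_of_ne_one`** — at a ramified non-split place, for every `x ∈ E_w` with `|x| ≤ 1` there is `y ∈ F_v`, `|y| ≤ 1`, with `|x − ι_w y|_w < 1`: the
  residue map `𝓀_v → 𝓀_w` induced by the local hom `ι_w` (★ `isUnit_toPlace_integer_iff`) is an injective ring map between finite fields of the same cardinality (★
  `natCard_residueField_eq_of_ramified`: `f(w|v) = 1`), hence onto.
* §3 THE SELECTOR (over ★ p857779): **`false_of_eisensteinDatum_of_ramificationIdx_eq_one`** (`e(w|v) = 1`, `r² = ι_w D`, `D = (u² + 4w)z²` Eisenstein ⇒ `False`) and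
  **`false_of_inertDatum_of_ramificationIdx_ne_one`** (`e(w|v) ≠ 1`, inert datum ⇒ `False`), datum in the `ValuativeRel` letters of ★ p857701's output.  With Mathlib's
  `e(w|v) = 1 ∨ e(w|v) ≠ 1` (or ★ `ramificationIdx_inertiaDeg_dichotomy_of_smul_eq`) the census file's class split and ★ p857701's disjunction coincide: `e(v″|v) = 1` ⇔ INERT
  (law `(q+1)qⁿ`, class U of heir LEAD T19-05 (1)), `e(v″|v) = 2` ⇔ EISENSTEIN (law `2q^{n+1}`, classes RK∕RM).
HONEST LABEL: HC_CM is proved only modulo the 7 printed citations (2 remaining named inputs: hLiu418 = stmt-HodgeConjecture-24832, h413 = stmt-HodgeConjecture-24833) until rung 0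
closes; (ρ2b′-X) stays OPEN; nothing printed is asserted — local algebra at a place.

## References
* [NeukirchANT1999] J. Neukirch, *Algebraic Number Theory*, Grundlehren 322 (1999), Ch. I §8 Prop. (8.2) (`e·f = 2` at a non-split prime of a quadratic extension), Ch. II §4 Prop. (4.3)
  (completions: `e`, `f` unchanged; the residue field of `E_w`).
* [Serre1979] J.-P. Serre, *Local Fields*, GTM 67 (1979), Ch. I §6 Prop. 17–18, Ch. III §5 Thm. 3.
-/

set_option autoImplicit false

noncomputable section

open NumberField IsDedekindDomain IsLocalRing ValuativeRel
open scoped ValuativeRel WithZero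

namespace Literature.NumberTheory.Automorphic.UnitaryGroup

open Literature.NumberTheory.Automorphic Literature.NumberTheory.Automorphic.HermitianLatticeTree

section Place

variable {F : Type} (E : Type) [Field F] [NumberField F] [Field E] [NumberField E] [Algebra F E] [Algebra.IsQuadraticExtension F E]
  (c : E ≃ₐ[F] E) (v : HeightOneSpectrum (𝓞 F)) (w : PlacesOver E v)

/-! ## §1 `|ι_w y|` by ramification index -/

omit [Algebra.IsQuadraticExtension F E] in
/-- `e(w|v) = 1` ⇒ `ι_w` is ISOMETRIC: `|ι_w y|_w = |y|_v` (★ `valued_toPlace`). [cite: NeukirchANT1999, Ch. II §4 Prop. (4.3)] -/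
theorem valued_toPlace_eq_self_of_ramificationIdx_eq_one (he1 : v.asIdeal.ramificationIdx' w.1.asIdeal = 1) (y : v.adicCompletion F) :
    Valued.v (toPlace v w y) = Valued.v y := by
  rw [valued_toPlace, he1, pow_one]

/-! ## §2 Residue approximation at a ramified non-split place (`f(w|v) = 1`) -/

/-- **RESIDUE APPROXIMATION ALONG `ι_w` AT A RAMIFIED NON-SPLIT PLACE**: for every `x ∈ E_w` with `|x|_w ≤ 1` there is `y ∈ F_v` with `|y|_v ≤ 1` and `|x − ι_w y|_w < 1`.  The residue
map induced by the local hom `ι_w : 𝒪_v → 𝒪[E_w]` is injective between finite residue fields of equal cardinality (`f(w|v) = 1`, ★ `natCard_residueField_eq_of_ramified`), hence onto.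
[cite: NeukirchANT1999, Ch. I §8 Prop. (8.2); Ch. II §4 Prop. (4.3)] -/
theorem exists_valued_sub_toPlace_lt_one_of_ne_one (hc : c ≠ 1) (hw : c • w.1 = w.1) (he : v.asIdeal.ramificationIdx' w.1.asIdeal ≠ 1)
    (x : w.1.adicCompletion E) (hx : Valued.v x ≤ 1) :
    ∃ y : v.adicCompletion F, Valued.v y ≤ 1 ∧ Valued.v (x - toPlace v w y) < 1 := by
  classical
  let φ : Valued.integer (v.adicCompletion F) →+* 𝒪[w.1.adicCompletion E] :=
    ((toPlace v w).comp (Valued.integer (v.adicCompletion F)).subtype).codRestrict 𝒪[w.1.adicCompletion E] fun y => toPlace_mem_integer E v w y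
  haveI : IsLocalHom φ := ⟨fun y hy => (isUnit_toPlace_integer_iff E v w y).1 hy⟩
  let ρ : ResidueField (Valued.integer (v.adicCompletion F)) →+* ResidueField 𝒪[w.1.adicCompletion E] := ResidueField.map φ
  -- `ρ` is a bijection: injective (field hom) between finite types of equal cardinality
  haveI : Finite (ResidueField 𝒪[w.1.adicCompletion E]) := inferInstance
  have hcard : Nat.card (ResidueField (Valued.integer (v.adicCompletion F))) = Nat.card (ResidueField 𝒪[w.1.adicCompletion E]) := by
    rw [show ResidueField (Valued.integer (v.adicCompletion F)) = Valued.ResidueField (v.adicCompletion F) from rfl,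
      ← natCard_residueField_eq_of_compatible, natCard_residueField_valuativeRel_eq, natCard_residueField_eq_of_ramified c v hc w hw he]
  haveI : Finite (ResidueField (Valued.integer (v.adicCompletion F))) := Nat.finite_of_card_ne_zero (by rw [hcard]; exact Nat.card_pos.ne')
  have hbij : Function.Bijective ρ := by
    rw [Nat.bijective_iff_injective_and_card]
    exact ⟨ρ.injective, hcard⟩
  -- lift the residue of `x`
  have hxO : x ∈ 𝒪[w.1.adicCompletion E] := (v_le_one_iff_mem_integer x).1 hx
  obtain ⟨ybar, hybar⟩ := hbij.2 (residue 𝒪[w.1.adicCompletion E] ⟨x, hxO⟩)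
  obtain ⟨y, rfl⟩ := residue_surjective ybar
  refine ⟨(y : v.adicCompletion F), (Valuation.mem_integer_iff _ _).1 y.2, ?_⟩
  have h0 : residue 𝒪[w.1.adicCompletion E] (⟨x, hxO⟩ - φ y) = 0 := by
    rw [map_sub, ← ResidueField.map_residue, sub_eq_zero]
    exact hybar.symm
  have hlt := (residue_eq_zero_iff_valuation_lt_one _).1 h0
  have hφy : ((φ y : 𝒪[w.1.adicCompletion E]) : w.1.adicCompletion E) = toPlace v w (y : v.adicCompletion F) := rfl
  refine (v_lt_one_iff_valuation_lt_one _).2 ?_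
  have : ((⟨x, hxO⟩ - φ y : 𝒪[w.1.adicCompletion E]) : w.1.adicCompletion E) = x - toPlace v w (y : v.adicCompletion F) := by
    rw [← hφy]; rfl
  rw [← this]; exact hlt

/-! ## §3 The class selector for a quadratic datum of `D ∈ F_v` with `√D ∈ E_w` -/

omit [Algebra.IsQuadraticExtension F E] in
/-- **`e(w|v) = 1` KILLS THE EISENSTEIN DATUM**: if `ι_w` is unramified at `w`, `r ∈ E_w` with `r² = ι_w D`, then `D` has no Eisenstein datum `D = (u² + 4w₀)z²` (`|u| < 1`, `|w₀| = |ϖ_v|`,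
`|ϖ_v| = exp(−1)`) — ★ p857779 `false_of_eisensteinDatum_of_isometry` at §1. (Datum letters: ★ `hSide_closedForm_of_tube`'s output.) [cite: Serre1979, Ch. I §6 Prop. 17–18] [cite: NeukirchANT1999, Ch. II §4 Prop. (4.3)] -/
theorem false_of_eisensteinDatum_of_ramificationIdx_eq_one (he1 : v.asIdeal.ramificationIdx' w.1.asIdeal = 1) (h2 : (2 : w.1.adicCompletion E) ≠ 0)
    {ϖ : v.adicCompletion F} (hϖ : Valued.v ϖ = WithZero.exp (-1 : ℤ)) {D u w₀ z : v.adicCompletion F} (hD : (u ^ 2 + 4 * w₀) * z ^ 2 = D) (hz : z ≠ 0)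
    (hu : valuation (v.adicCompletion F) u < 1) (hw₀ : valuation (v.adicCompletion F) w₀ = valuation (v.adicCompletion F) ϖ)
    {r : w.1.adicCompletion E} (hr : r ^ 2 = toPlace v w D) : False :=
  false_of_eisensteinDatum_of_isometry (toPlace v w) (valued_toPlace_eq_self_of_ramificationIdx_eq_one E v w he1) h2 hϖ hD hz hu hw₀ hr

/-- **`e(w|v) ≠ 1` (RAMIFIED NON-SPLIT) KILLS THE INERT DATUM**: with `c • w = w`, `e(w|v) ≠ 1`, `r ∈ E_w` with `r² = ι_w D`, `D` has no inert datum `D = (u² + 4w₀)z²` (`u w₀ ∈ 𝒪_v`, norm form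
`c² + ceu − e²w₀` anisotropic mod `𝔭_v`) — ★ p857779 `false_of_inertDatum_of_sq_of_residue` at §1 + §2. [cite: Serre1979, Ch. III §5 Thm. 3] [cite: NeukirchANT1999, Ch. I §8 Prop. (8.2)] -/
theorem false_of_inertDatum_of_ramificationIdx_ne_one (hc : c ≠ 1) (hw : c • w.1 = w.1) (he : v.asIdeal.ramificationIdx' w.1.asIdeal ≠ 1) (h2 : (2 : w.1.adicCompletion E) ≠ 0)
    {D u w₀ z : v.adicCompletion F} (hD : (u ^ 2 + 4 * w₀) * z ^ 2 = D) (hz : z ≠ 0)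
    (hu : u ∈ 𝒪[v.adicCompletion F]) (hw₀ : w₀ ∈ 𝒪[v.adicCompletion F])
    (hanis : ∀ a b : v.adicCompletion F, a ∈ 𝒪[v.adicCompletion F] → b ∈ 𝒪[v.adicCompletion F] →
      valuation (v.adicCompletion F) (a ^ 2 + a * b * u - b ^ 2 * w₀) < 1 → valuation (v.adicCompletion F) a < 1 ∧ valuation (v.adicCompletion F) b < 1)
    {r : w.1.adicCompletion E} (hr : r ^ 2 = toPlace v w D) : False :=
  false_of_inertDatum_of_sq_of_residue (toPlace v w) (valued_toPlace_eq_pow_two_of_ramified c w hc hw he)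
    (exists_valued_sub_toPlace_lt_one_of_ne_one E c v w hc hw he) h2 hD hz hu hw₀ hanis hr

end Place

end Literature.NumberTheory.Automorphic.UnitaryGroup

end
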